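import Summits.ValiantsHypothesis.ValiantsHypothesis.Theorems.DefinabilityGapZeroedBlocks
import Summits.ValiantsHypothesis.ValiantsHypothesis.Theorems.DefinabilityGapSupportRung
import HarnessLib

/-!
# DefinabilityGap — `G_m` hits TRIANGULAR SECTIONS: fewer than `m/2` pivots, any size, any degree

Route `route-ValiantsHypothesis-DefinabilityGap` (decomp-valiant cycle 1, lens 5: hardness–randomness / PIT axis); size road
of the residual `KIPlantedHitting` (stmt-ValiantsHypothesis-23547; census cells W5 / W19), read-once leaf F4 / W10
(`KIPlantedHittingRO`, stmt-ValiantsHypothesis-23704). `G_m : y ↦ (P_c(y))_c`, `P_c = kiPer m c`, `φ = bind₁ (kiPer m)`.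
Stage 2 of the called offer O-L5-D3 (the linear-section road `E(r)`), delivered for ALL `r < m/2` at once and in a
non-linear form, by SPECIALISATION instead of the prime pencil:

* `zeroOut_outside_kiPer_of_mem / _of_notMem`: zero every seed variable outside the cells of a set `T` of blocks with
  `2·|T| < m`. The blocks of `T` keep their permanents; every other block meets `⋃_{c ∈ T} cells c` in `≤ 2|T| < m` cells
  (design intersections `≤ 2`, `card_cells_inter_le`), so none of its permutation monomials survives: its permanent dies.
* `kiPer_algebraicIndependent_sections`: for pivots `T` (`2|T| < m`) and ARBITRARY polynomials `n_i` in the non-pivot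
  block variables, the images `φ(z_i + n_i)` (`i ∈ T`) are algebraically independent — after the specialisation they
  become `P_i + n_i(0)`, and few block permanents are algebraically independent (`kiPer_algebraicIndependent`, the KI
  design lemma of `DefinabilityGapSupportRung`); `AlgebraicIndependent.of_comp` pulls this back.
* `kiPer_hits_sections`: hence `G_m` hits every non-zero `D = Φ(z_{c_1} + n_1, …, z_{c_r} + n_r)`, `r < m/2`, of any size
  and degree. With LINEAR `n_i` these are exactly the polynomials in `r` linearly independent linear forms brought to reduced
  row-echelon form, i.e. `E(r)`: every non-zero `D` with `< m/2` essential variables is hit (the Gaussian elimination is not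
  formalised here; the theorem is stated in pivot form).
Honest ceiling: `< m/2 ≈ √q/2` pivots; products of many affine forms (`DefinabilityGapSigmaPiSigmaTwo`) are NOT sections of
few pivots, and neither rung touches clause `b ≥ 2` of `KIPlantedHitting`: 0 S-currency. 0 sorry.
-/

noncomputable section

open MvPolynomial
open Literature.Computability.AlgebraicComplexity Literature.Computability.MetaComplexity

namespace Summit.ValiantsHypothesis.ValiantsHypothesis.Theorems.DefinabilityGapTriangularSections

open Summit.ValiantsHypothesis.ValiantsHypothesis.Theorems.DefinabilityGapAffineRung
open Summit.ValiantsHypothesis.ValiantsHypothesis.Theorems.DefinabilityGapPatternPermanent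
open Summit.ValiantsHypothesis.ValiantsHypothesis.Theorems.DefinabilityGapZeroedBlocks
open Summit.ValiantsHypothesis.ValiantsHypothesis.Theorems.DefinabilityGapSupportRung

variable {m : ℕ}

/-! ## 1. Zeroing every seed variable outside a set of blocks -/

/-- The seed variables outside the cells of the blocks of `T`. [this file] -/
def outside (m : ℕ) (T : Finset (Fin 3 → Fin (qOf m))) : Finset (Fin (qOf m) × Fin (qOf m)) :=
  Finset.univ.filter fun v => ∀ c ∈ T, v ∉ cells m c

/-- Membership in `outside`. [this file] -/
theorem mem_outside {T : Finset (Fin 3 → Fin (qOf m))} {v : Fin (qOf m) × Fin (qOf m)} :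
    v ∈ outside m T ↔ ∀ c ∈ T, v ∉ cells m c := by
  simp [outside]

/-- The blocks of `T` keep their permanents. [this file] -/
theorem zeroOut_outside_kiPer_of_mem {T : Finset (Fin 3 → Fin (qOf m))} {c : Fin 3 → Fin (qOf m)} (hc : c ∈ T) :
    zeroOut m (outside m T) (kiPer m c) = kiPer m c := by
  have hpat : patOf m (outside m T) c = ∅ := by
    ext rc
    simp only [mem_patOf, mem_outside, Finset.notMem_empty, iff_false]
    intro h
    exact h c hc (Finset.mem_map_of_mem _ (Finset.mem_univ rc))
  show kiPerZ m (outside m T) c = kiPer m c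
  rw [kiPerZ_eq_rename, hpat, ← patOf_empty c, ← kiPerZ_eq_rename, kiPerZ_empty]

/-- **Every other block dies** (`2|T| < m`): its free cells lie in `⋃_{c' ∈ T} (cells c ∩ cells c')`, `≤ 2|T| < m` of them,
too few for a permutation monomial. [this file] -/
theorem zeroOut_outside_kiPer_of_notMem {T : Finset (Fin 3 → Fin (qOf m))} (hT : 2 * T.card < m)
    {c : Fin 3 → Fin (qOf m)} (hc : c ∉ T) : zeroOut m (outside m T) (kiPer m c) = 0 := by
  classical
  show kiPerZ m (outside m T) c = 0
  rw [kiPerZ_eq_rename]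
  suffices h : perPat ℂ (patOf m (outside m T) c) = 0 by rw [h, map_zero]
  ext d
  rw [coeff_zero]
  by_contra hd
  obtain ⟨ρ, hρ, -⟩ := exists_of_coeff_perPat_ne_zero ℂ hd
  have hinj : Function.Injective (fun i : Fin m => cellEmb m c (ρ i, i)) := fun i j h => by
    have := (cellEmb m c).injective h
    simpa using congrArg Prod.snd this
  have hA : (Finset.univ.image fun i : Fin m => cellEmb m c (ρ i, i)).card = m := by
    rw [Finset.card_image_of_injective _ hinj, Finset.card_univ, Fintype.card_fin]
  have hsub : (Finset.univ.image fun i : Fin m => cellEmb m c (ρ i, i)) ⊆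
      T.biUnion fun c' => cells m c ∩ cells m c' := by
    intro x hx
    rw [Finset.mem_image] at hx
    obtain ⟨i, -, rfl⟩ := hx
    have hfree : cellEmb m c (ρ i, i) ∉ outside m T := fun h => hρ i (mem_patOf.2 h)
    rw [mem_outside] at hfree
    push Not at hfree
    obtain ⟨c', hc', hcell⟩ := hfree
    rw [Finset.mem_biUnion]
    exact ⟨c', hc', Finset.mem_inter.2 ⟨Finset.mem_map_of_mem _ (Finset.mem_univ _), hcell⟩⟩
  have hcard : (T.biUnion fun c' => cells m c ∩ cells m c').card ≤ T.card * 2 :=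
    Finset.card_biUnion_le_card_mul _ _ _ fun c' hc' => card_cells_inter_le fun h => hc (h ▸ hc')
  have := Finset.card_le_card hsub
  rw [hA] at this
  omega

/-- After the specialisation, substituting into a polynomial in NON-pivot block variables leaves its constant term. [this file] -/
theorem bind₁_zeroOut_kiPer_of_vars {T : Finset (Fin 3 → Fin (qOf m))} (hT : 2 * T.card < m)
    (n : MvPolynomial (Fin 3 → Fin (qOf m)) ℂ) (hn : ∀ c ∈ n.vars, c ∉ T) :
    bind₁ (fun c => zeroOut m (outside m T) (kiPer m c)) n = C (constantCoeff n) := by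
  have hC : (bind₁ (fun c => zeroOut m (outside m T) (kiPer m c))).toRingHom.comp C =
      (aeval (R := ℂ) (0 : (Fin 3 → Fin (qOf m)) → MvPolynomial (Fin (qOf m) × Fin (qOf m)) ℂ)).toRingHom.comp C := by
    refine RingHom.ext fun r => ?_
    change bind₁ (fun c => zeroOut m (outside m T) (kiPer m c)) (C r) =
      aeval (R := ℂ) (0 : (Fin 3 → Fin (qOf m)) → MvPolynomial (Fin (qOf m) × Fin (qOf m)) ℂ) (C r)
    rw [bind₁_C_right, aeval_C, algebraMap_eq]
  have hv : ∀ c, c ∈ n.vars → c ∈ n.vars →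
      (bind₁ (fun c => zeroOut m (outside m T) (kiPer m c))).toRingHom (X c) =
        (aeval (R := ℂ) (0 : (Fin 3 → Fin (qOf m)) → MvPolynomial (Fin (qOf m) × Fin (qOf m)) ℂ)).toRingHom (X c) := by
    intro c hc _
    change bind₁ (fun c => zeroOut m (outside m T) (kiPer m c)) (X c) =
      aeval (R := ℂ) (0 : (Fin 3 → Fin (qOf m)) → MvPolynomial (Fin (qOf m) × Fin (qOf m)) ℂ) (X c)
    rw [bind₁_X_right, aeval_X, Pi.zero_apply]
    exact zeroOut_outside_kiPer_of_notMem hT (hn c hc)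
  have key := hom_congr_vars hC hv (rfl : n = n)
  change bind₁ (fun c => zeroOut m (outside m T) (kiPer m c)) n =
    aeval (R := ℂ) (0 : (Fin 3 → Fin (qOf m)) → MvPolynomial (Fin (qOf m) × Fin (qOf m)) ℂ) n at key
  rw [key, aeval_zero, algebraMap_eq]

/-- **The specialised image of a triangular section** `z_i + n_i` (`i` a pivot, `n_i` in non-pivot variables) is
`P_i + n_i(0)`. [this file] -/
theorem zeroOut_bind₁_kiPer_section {T : Finset (Fin 3 → Fin (qOf m))} (hT : 2 * T.card < m)
    {i : Fin 3 → Fin (qOf m)} (hi : i ∈ T) (n : MvPolynomial (Fin 3 → Fin (qOf m)) ℂ) (hn : ∀ c ∈ n.vars, c ∉ T) :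
    zeroOut m (outside m T) (bind₁ (kiPer m) (X i + n)) = kiPer m i + C (constantCoeff n) := by
  rw [zeroOut_bind₁, map_add, bind₁_X_right, zeroOut_outside_kiPer_of_mem hi, bind₁_zeroOut_kiPer_of_vars hT n hn]

/-! ## 2. Triangular sections are algebraically independent under `G_m` -/

/-- **Triangular sections of `G_m` are algebraically independent**: for a set `T` of pivot blocks with `2|T| < m` and
arbitrary polynomials `n_i` in the non-pivot block variables, the polynomials `φ(z_i + n_i)`, `i ∈ T`, are algebraically
independent over `ℂ`. [this file] -/
theorem kiPer_algebraicIndependent_sections (T : Finset (Fin 3 → Fin (qOf m))) (hT : 2 * T.card < m)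
    (n : T → MvPolynomial (Fin 3 → Fin (qOf m)) ℂ) (hn : ∀ i, ∀ c ∈ (n i).vars, c ∉ T) :
    AlgebraicIndependent ℂ (fun i : T => bind₁ (kiPer m) (X (i : Fin 3 → Fin (qOf m)) + n i)) := by
  refine AlgebraicIndependent.of_comp (zeroOut m (outside m T)) ?_
  have hfun : (zeroOut m (outside m T)) ∘ (fun i : T => bind₁ (kiPer m) (X (i : Fin 3 → Fin (qOf m)) + n i)) =
      fun i : T => aeval (fun c : T => kiPer m c) ((C 1 * X i + C (constantCoeff (n i)) : MvPolynomial T ℂ)) := by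
    funext i
    rw [Function.comp_apply, zeroOut_bind₁_kiPer_section hT i.2 (n i) (hn i), map_add, map_mul, aeval_C, aeval_C,
      aeval_X, algebraMap_eq, C_1, one_mul]
  rw [hfun]
  have hm : 2 * (T.card - 1) < m * m := by
    have h1 := Nat.le_mul_self m
    omega
  exact (kiPer_algebraicIndependent m T hm).aeval_of_algebraicIndependent
    (KIPrivate.algebraicIndependent_affine (fun _ => (1 : ℂ)) (fun i => constantCoeff (n i)) fun _ => one_ne_zero)

/-- **`G_m` hits every non-zero polynomial in fewer than `m/2` triangular sections** — any size, any degree. [this file] -/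
theorem kiPer_hits_sections (T : Finset (Fin 3 → Fin (qOf m))) (hT : 2 * T.card < m)
    (n : T → MvPolynomial (Fin 3 → Fin (qOf m)) ℂ) (hn : ∀ i, ∀ c ∈ (n i).vars, c ∉ T)
    (Φ : MvPolynomial T ℂ) (hΦ : Φ ≠ 0) :
    bind₁ (kiPer m) (aeval (fun i : T => X (i : Fin 3 → Fin (qOf m)) + n i) Φ) ≠ 0 := by
  have h := kiPer_algebraicIndependent_sections T hT n hn
  rw [algebraicIndependent_iff] at h
  intro h0
  rw [← AlgHom.comp_apply, comp_aeval] at h0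
  exact hΦ (h Φ h0)

/-- The LINEAR case (`E(r)` in pivot form): for pivots `T` with `2|T| < m` and linear forms `z_i + ∑_{c ∉ T} a_{ic} z_c`,
every non-zero polynomial in them is hit by `G_m`. [this file] -/
theorem kiPer_hits_linearSections (T : Finset (Fin 3 → Fin (qOf m))) (hT : 2 * T.card < m)
    (a : T → (Fin 3 → Fin (qOf m)) → ℂ) (ha : ∀ i c, c ∈ T → a i c = 0) (Φ : MvPolynomial T ℂ) (hΦ : Φ ≠ 0) :
    bind₁ (kiPer m) (aeval (fun i : T => X (i : Fin 3 → Fin (qOf m)) + ∑ c, C (a i c) * X c) Φ) ≠ 0 := by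
  classical
  refine kiPer_hits_sections T hT (fun i => ∑ c, C (a i c) * X c) (fun i c hc hcT => ?_) Φ hΦ
  have h0 : (∑ c', C (a i c') * X c' : MvPolynomial (Fin 3 → Fin (qOf m)) ℂ) =
      ∑ c' ∈ Finset.univ.filter (fun c' => c' ∉ T), C (a i c') * X c' := by
    rw [Finset.sum_filter]
    refine Finset.sum_congr rfl fun c' _ => ?_
    by_cases h : c' ∈ T
    · rw [if_neg (fun h' => h' h), ha i c' h, C_0, zero_mul]
    · rw [if_pos h]
  rw [h0] at hc
  have hsub := vars_sum_subset (Finset.univ.filter fun c' => c' ∉ T) (fun c' => C (a i c') * X c') hc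
  rw [Finset.mem_biUnion] at hsub
  obtain ⟨c', hc', hcc'⟩ := hsub
  have hx : c ∈ (X c' : MvPolynomial (Fin 3 → Fin (qOf m)) ℂ).vars := by
    have := vars_mul (C (a i c')) (X c')
    rw [vars_C, Finset.empty_union] at this
    exact this hcc'
  rw [vars_X, Finset.mem_singleton] at hx
  subst hx
  exact (Finset.mem_filter.1 hc').2 hcT

end Summit.ValiantsHypothesis.ValiantsHypothesis.Theorems.DefinabilityGapTriangularSections
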